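/-
Copyright (c) 2026 the pub-hodgecm-mathlib formalisation cell (harness21).  Prover seat hodgecm-mathlib-LH4-p02 (g0): road «S3-ram» (LEAD F0P3a-plan (g13); junction pen
F0P3a-p01 (g17), J-PACK v2-iso; S45 pen F0P3a-p02 (g17); HYP-PLAN v1 of F0P3a-p04 (g19), node (V3) split by F0P3-p03 (g15): (V3)(i) «REGION DIRECTION COUNT»); 2026-09-02.
-/
import Literature.NumberTheory.Automorphic.UnitaryLatticeTreeRootStarPredicateCountRamified          -- ★ G3⁗ p847467 (F0P2-p06): the `p ↦ N_{x_p}` bridge currency; brings ★ R2b, ★ G3′, ★ G3″ (`normalParam` facts)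
import Literature.NumberTheory.Rogawski1990.DepthZeroKappaTransferTypeOneRamifiedIsocelesRootCensus    -- ★ p847712 (F0P3a-p02): `sum_ite_sq_eq_eq` (`#{z : z² = b} = χ(b) + 1`)
import Literature.NumberTheory.Automorphic.UnitaryLatticeTreeIsTreeDiagonalRamified                  -- ★ `ringChar_residueField_ne_two`
import HarnessLib

/-!
# The lattice graph of a hermitian space — THE REGION-DIRECTION COUNT at a vertex: children whose line is residually ORTHOGONAL to given test vectors
# (`1 + χ(Q(w̄))` ∕ `2` ∕ `1`; Bruhat–Tits 1972 §10; Kottwitz 1986 §3; Serre, *Trees* II.1.1)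

Topic `NumberTheory/Automorphic`; namespace `Literature.NumberTheory.Automorphic.UnitaryLatticeTree`.  THEOREMS ONLY (no definition, no instance, no notation, no named fact,
no `sorry`); kernel lane `--supports stmt-HodgeConjecture-24833`.  Cell `pub/hodgecm-mathlib` (D-0151), crux H413; road «S3-ram» (Literature seeding, count-neutral); the
(a2) JUNCTION of the type-(1) ramified row, isoceles wave, S45 supplier `row_S45_hyperbolic` as the DAG of F0P3a-p04 (g19)'s HYP-PLAN v1 94da24021e513485, node (V3)
«REGION DIRECTIONS + LAYERS», split by F0P3-p03 (g15) 02:47:42Z: **(V3)(i) = THIS FILE** (the residual line count), (ii)–(iv) = F0P3-p03's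
`UnitaryLatticeTreeIsocelesRegionBranchingRamified` (keyed slice, inward direction, layer assembly — it keys its `hdir0 ∕ hdirI ∕ hdirE` binders on §3 here).

THE MATHEMATICS.  By ★ LINE TEST `lev_iff_v_pairing_lt_one_of_adj_keyed` (F0P3-p03), the far side of the child `(uκ)·N₁` of a region vertex `v = u·L₀` lies in the region iff the
child's line `x = (uκ)e₀` satisfies the two LINEAR tests `|⟨x, A e_{i₀}⟩| < 1 ∧ |⟨x, ϖ^{s′}·A e_k⟩| < 1`.  Writing the test vectors as `u·y₁`, `u·y₂` with `y₁, y₂ ∈ 𝒪³`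
(unitarity: `⟨u x′, u y⟩ = ⟨x′, y⟩ = B₀(x′, y)`), the number of such children is the number of normalised isotropic parameters `p` of the residual conic (★ R2b ∕ G3″) with
`ᵗx̄_p J̄₀ ȳ₁ = 0 ∧ ᵗx̄_p J̄₀ ȳ₂ = 0` — the same `p ↦ N_{x_p}` bijection as ★ G3⁗ `ncard_neighborSet_pred_eq_natCard`, the LINEAR test being frame-independent by the
residual-hyperplane dictionary (★ `forall_v_B₀_lt_one_iff_of_exists_unit_congr`) — and that number is elementary geometry of the split ternary quadratic space `(𝓀³, J̄₀)`:
* §1 (finite field `k`, `char k ≠ 2`): `normalParam_dotProduct_mulVec` (the pairing of `x̄_p` with `w`), **`normalParam_dotProduct_mulVec_normalParam_eq_zero_iff`** (DISTINCT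
  ISOTROPIC LINES ARE NEVER ORTHOGONAL), `param_of_fst` ∕ `sum_params_eq_sum` (the affine parameters are `(a, −a²∕2)`), **`natCard_params_orthogonal_eq`** (for `w` anisotropic the
  isotropic lines `⊥ w` number `1 + χ(Q(w))`: complete the square in `w₂ + a w₁ − (a²∕2)w₀ = 0`), `natCard_params_orthogonal_eq_two` (a non-zero isotropic `z ⊥ w` forces
  `χ(Q(w)) = 1`: exactly `2`), `natCard_params_orthogonal_orthogonal_eq_one` (`m ≠ 0` isotropic `⊥ w`: the only isotropic line `⊥ w, m` is the line of `m`: exactly `1`).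
* §2 (the lattice tree, tame-ramified tokens of ★ G3⁗): `v_B₀_lt_one_iff_residue` (`|B₀(x, y)| < 1 ↔ ᵗx̄J̄₀ȳ = 0`), `v_B₀_normalForm_lt_one_iff_residue`,
  **`ncard_neighborSet_root_linTest_eq_natCard`** (the bridge at the root, `B₀(κe₀, yᵢ)` spelling) and **`ncard_neighborSet_linTest_eq_natCard`** (at `u·L₀`, children
  `(uκ)·N₁`, `pairing σ J₀ ((uκ)e₀) (u yᵢ)` spelling = the ★ LINE TEST's).
* §3 THE THREE COUNTS at `u·L₀`: **`ncard_children_linTest_eq_one_add_quadraticChar`** (`y₂ ∈ ϖ𝒪³`, `ȳ₁` anisotropic: `1 + χ(Q(ȳ₁))`, in `ℤ`),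
  **`ncard_children_linTest_eq_two`** (plus a primitive residually-isotropic witness `z ⊥ y₁`: `= 2` — at the root the witness is `A(e_j + t e_k)` from the S45 token `hhyp`, at an
  interior vertex the inward line), **`ncard_children_linTest_eq_one`** (`y₂` primitive, residually isotropic and `⊥ y₁` — the END vertices: `= 1`).
* §4 (ED. 2, append-only) THE SAME IN REG-DIRECTION CURRENCY — the set `{c | Adj v c ∧ ∃ κ ∈ K₀, c = (uκ)·N₁ ∧ RegDir_u κ}` of ★ `UnitaryLatticeTreeIsocelesRegionBranchingRamified`
  (F0P3-p03) CHARACTER FOR CHARACTER, test vectors `A e_{i₀} = u·y₁`, `ϖ^{s′}·A e_k = u·y₂`: `ncard_adj_regDir_eq_natCard`, `ncard_adj_regDir_eq_one_add_quadraticChar`,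
  `ncard_adj_regDir_eq_two`, `ncard_adj_regDir_eq_one` (ref5 R-379's three rewrites performed here once).
HONEST LABEL: HC_CM is proved only modulo the 2 remaining named inputs (hLiu418 24832, h413 24833) until rung 0 closes; finite-field geometry and residual bookkeeping over ★
results, nothing printed is asserted; «S3-ram» has no books consequence.

## References
* [BruhatTits1972] F. Bruhat, J. Tits, *Groupes réductifs sur un corps local I*, Publ. Math. IHÉS 41 (1972), §10 (the star of a vertex = the residual conic).
* [Kottwitz1986] R. E. Kottwitz, *Base change for unit elements of Hecke algebras*, Compositio Math. 60 (1986), §3 (counting fixed lattices by residual data).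
* [Serre1980Trees] J.-P. Serre, *Trees* (1980), Ch. II §1.1 (neighbours of a lattice ↔ points of the residual conic).
* [Tits1979] J. Tits, *Reductive groups over local fields*, PSPM 33.1 (1979), §2.4, §3.5.
* [Wilson2009] R. A. Wilson, *The Finite Simple Groups*, GTM 251 (2009), §3.7.1 (isotropic vectors of the ternary split form).
* [IrelandRosen1990] K. Ireland, M. Rosen, *A Classical Introduction to Modern Number Theory*, 2nd ed. (1990), Ch. 8 §1 (sums of the quadratic character).
-/

set_option autoImplicit false

noncomputable section

open scoped Valued WithZero Matrix MatrixGroups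
open Finset

namespace Literature.NumberTheory.Automorphic.UnitaryLatticeTree

open Literature.NumberTheory.Automorphic Literature.NumberTheory.Automorphic.HermitianLattice
open Literature.GroupTheory.SpecificGroups Literature.NumberTheory.Rogawski1990

/-! ## §1 Finite-field half: isotropic lines of `(k³, J̄₀)` orthogonal to a vector -/

section FiniteField

variable {k : Type*} [Field k]

/-- `ᵗe₂ J̄₀ w = w₀`. [cite: Wilson2009, §3.7.1 p. 70] -/
theorem single_two_dotProduct_antidiagonal_mulVec (w : Fin 3 → k) :
    (Pi.single 2 1 : Fin 3 → k) ⬝ᵥ (((StdForm.antidiagonal 3).over k) *ᵥ w) = w 0 := by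
  rw [dotProduct_antidiagonal_three_mulVec_eq_sum, Fin.sum_univ_three]
  simp [show Fin.rev (2 : Fin 3) = 0 from rfl]

/-- `ᵗ(1, a, b) J̄₀ w = w₂ + a w₁ + b w₀`. [cite: Wilson2009, §3.7.1 p. 70] -/
theorem vec3_one_dotProduct_antidiagonal_mulVec (a b : k) (w : Fin 3 → k) :
    (![(1 : k), a, b] : Fin 3 → k) ⬝ᵥ (((StdForm.antidiagonal 3).over k) *ᵥ w) = w 2 + a * w 1 + b * w 0 := by
  rw [dotProduct_antidiagonal_three_mulVec_eq_sum, Fin.sum_univ_three]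
  simp [show Fin.rev (2 : Fin 3) = 0 from rfl, show Fin.rev (0 : Fin 3) = 2 from rfl, show Fin.rev (1 : Fin 3) = 1 from rfl]

/-- The pairing of a normalised parameter vector with `w`: `ᵗx̄_∞ J̄₀ w = w₀`, `ᵗx̄_{(a,b)} J̄₀ w = w₂ + a w₁ + b w₀`. [cite: Wilson2009, §3.7.1 p. 70] -/
theorem normalParam_dotProduct_mulVec (p : Option {p : k × k // p.2 + (RingHom.id k) p.2 + p.1 * (RingHom.id k) p.1 = 0}) (w : Fin 3 → k) :
    (p.elim (Pi.single 2 1) fun q => ![(1 : k), q.1.1, q.1.2]) ⬝ᵥ (((StdForm.antidiagonal 3).over k) *ᵥ w) =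
      p.elim (w 0) fun q => w 2 + q.1.1 * w 1 + q.1.2 * w 0 := by
  rcases p with _ | q
  · exact single_two_dotProduct_antidiagonal_mulVec w
  · exact vec3_one_dotProduct_antidiagonal_mulVec _ _ w

/-- **DISTINCT ISOTROPIC LINES ARE NEVER ORTHOGONAL** in the split ternary quadratic space `(k³, J̄₀)` (`char k ≠ 2`): `ᵗx̄_p J̄₀ x̄_{p′} = 0 ↔ p = p′` (a totally isotropic
subspace of a non-degenerate ternary space is a line). [cite: Wilson2009, §3.7.1 p. 70] [cite: BruhatTits1972, §10] -/
theorem normalParam_dotProduct_mulVec_normalParam_eq_zero_iff (h2 : (2 : k) ≠ 0)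
    (p p' : Option {p : k × k // p.2 + (RingHom.id k) p.2 + p.1 * (RingHom.id k) p.1 = 0}) :
    (p.elim (Pi.single 2 1) fun q => ![(1 : k), q.1.1, q.1.2]) ⬝ᵥ
        (((StdForm.antidiagonal 3).over k) *ᵥ (p'.elim (Pi.single 2 1) fun q => ![(1 : k), q.1.1, q.1.2])) = 0 ↔ p = p' := by
  constructor
  · intro h
    rw [normalParam_dotProduct_mulVec] at h
    rcases p with _ | ⟨⟨a, b⟩, hab⟩ <;> rcases p' with _ | ⟨⟨a', b'⟩, hab'⟩
    · rfl
    · simp at h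
    · simp at h
    · simp only [RingHom.id_apply] at hab hab'
      simp only [Option.elim_some, Matrix.cons_val_zero, Matrix.cons_val_one, Matrix.cons_val_two, Matrix.head_cons, Matrix.tail_cons, mul_one] at h
      -- `2(b′ + a a′ + b) = −(a − a′)²`
      have hsq : (a - a') ^ 2 = 0 := by linear_combination hab + hab' - 2 * h
      have ha : a = a' := sub_eq_zero.1 (pow_eq_zero_iff two_ne_zero |>.1 hsq)
      subst ha
      have hb : b = b' := mul_left_cancel₀ h2 (by linear_combination hab - hab')
      subst hb
      rfl
  · rintro rfl
    exact normalParam_isotropic p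


/-- `(a, −a²∕2)` is an affine parameter (`2b + a² = 0`; `char k ≠ 2`). [cite: Wilson2009, §3.7.1 p. 70] -/
theorem param_of_fst (h2 : (2 : k) ≠ 0) (a : k) :
    ((a, -(a ^ 2) / 2) : k × k).2 + (RingHom.id k) ((a, -(a ^ 2) / 2) : k × k).2 + ((a, -(a ^ 2) / 2) : k × k).1 * (RingHom.id k) ((a, -(a ^ 2) / 2) : k × k).1 = 0 := by
  have h : (-(a ^ 2) + -(a ^ 2)) / 2 = -(a ^ 2) := by rw [div_eq_iff h2]; ring
  simp only [RingHom.id_apply]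
  rw [← add_div, h]
  ring

variable [Fintype k] [DecidableEq k]

/-- A sum over the affine parameters `{(a, b) : 2b + a² = 0}` is the sum over `a ∈ k` with `b = −a²∕2` (`char k ≠ 2`). [cite: Wilson2009, §3.7.1 p. 70] -/
theorem sum_params_eq_sum (h2 : (2 : k) ≠ 0) (f : k → k → ℤ) :
    ∑ q : {p : k × k // p.2 + (RingHom.id k) p.2 + p.1 * (RingHom.id k) p.1 = 0}, f q.1.1 q.1.2 = ∑ a : k, f a (-(a ^ 2) / 2) := by
  refine Fintype.sum_equiv
    { toFun := fun q => q.1.1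
      invFun := fun a => ⟨(a, -(a ^ 2) / 2), param_of_fst h2 a⟩
      left_inv := by
        rintro ⟨⟨a, b⟩, hab⟩
        simp only [RingHom.id_apply] at hab
        have hb : -(a ^ 2) / 2 = b := by
          rw [div_eq_iff h2]
          linear_combination -hab
        refine Subtype.ext ?_
        show ((a, -(a ^ 2) / 2) : k × k) = (a, b)
        rw [hb]
      right_inv := fun a => rfl } _ _ (fun q => ?_)
  obtain ⟨⟨a, b⟩, hab⟩ := q
  simp only [RingHom.id_apply] at hab
  have hb : b = -(a ^ 2) / 2 := by
    rw [eq_div_iff h2]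
    linear_combination hab
  simp only [Equiv.coe_fn_mk, hb]

/-- **THE ORTHOGONALITY CENSUS**: for `w` ANISOTROPIC (`ᵗwJ̄₀w ≠ 0`, `char k ≠ 2`) the isotropic lines orthogonal to `w` number `1 + χ(ᵗwJ̄₀w)` — the plane `w^⊥` is
hyperbolic or anisotropic according to the square class of `Q(w) = 2w₀w₂ + w₁²`. [cite: Wilson2009, §3.7.1 p. 70] [cite: IrelandRosen1990, Ch. 8 §1] -/
theorem natCard_params_orthogonal_eq (hk : ringChar k ≠ 2) {w : Fin 3 → k} (hw : w ⬝ᵥ (((StdForm.antidiagonal 3).over k) *ᵥ w) ≠ 0) :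
    ((Nat.card {p : Option {p : k × k // p.2 + (RingHom.id k) p.2 + p.1 * (RingHom.id k) p.1 = 0} //
        (p.elim (Pi.single 2 1) fun q => ![(1 : k), q.1.1, q.1.2]) ⬝ᵥ (((StdForm.antidiagonal 3).over k) *ᵥ w) = 0} : ℕ) : ℤ) =
      1 + quadraticChar k (w ⬝ᵥ (((StdForm.antidiagonal 3).over k) *ᵥ w)) := by
  have h2 : (2 : k) ≠ 0 := Ring.two_ne_zero hk
  have hQ : w ⬝ᵥ (((StdForm.antidiagonal 3).over k) *ᵥ w) = 2 * w 0 * w 2 + w 1 ^ 2 := by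
    rw [dotProduct_antidiagonal_three_mulVec]; ring
  -- the affine condition without denominators: `w₂ + a w₁ − (a²∕2) w₀ = 0 ⟺ 2w₂ + 2a w₁ − a² w₀ = 0`
  have hcond : ∀ a : k, (w 2 + a * w 1 + (-(a ^ 2) / 2) * w 0 = 0) ↔ (2 * w 2 + 2 * a * w 1 - a ^ 2 * w 0 = 0) := fun a => by
    have e2 : (2 : k) * (-(a ^ 2) / 2) = -(a ^ 2) := by field_simp
    have e : (2 : k) * (w 2 + a * w 1 + (-(a ^ 2) / 2) * w 0) = 2 * w 2 + 2 * a * w 1 - a ^ 2 * w 0 := by linear_combination w 0 * e2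
    constructor
    · intro h; rw [← e, h, mul_zero]
    · intro h; exact (mul_eq_zero.1 (e.trans h)).resolve_left h2
  -- Step 1: the count as an `ite`-sum — `∞` split off, the affine parameters summed over `a`
  have step1 : ((Nat.card {p : Option {p : k × k // p.2 + (RingHom.id k) p.2 + p.1 * (RingHom.id k) p.1 = 0} //
        (p.elim (Pi.single 2 1) fun q => ![(1 : k), q.1.1, q.1.2]) ⬝ᵥ (((StdForm.antidiagonal 3).over k) *ᵥ w) = 0} : ℕ) : ℤ) =
      (if w 0 = 0 then 1 else 0) + ∑ a : k, (if 2 * w 2 + 2 * a * w 1 - a ^ 2 * w 0 = 0 then (1 : ℤ) else 0) := by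
    rw [Nat.card_eq_fintype_card, Fintype.card_subtype, Finset.card_filter, Fintype.sum_option]
    push_cast
    rw [← sum_params_eq_sum h2 (fun a b => if w 2 + a * w 1 + b * w 0 = 0 then (1 : ℤ) else 0) |>.trans
      (Finset.sum_congr rfl fun a _ => by simp only [hcond a])]
    congr 1
    · simp only [Option.elim_none, single_two_dotProduct_antidiagonal_mulVec]
    · refine Finset.sum_congr rfl fun q _ => ?_
      simp only [Option.elim_some, vec3_one_dotProduct_antidiagonal_mulVec]
  rw [step1, hQ]
  by_cases hw0 : w 0 = 0
  · -- `w₀ = 0`: `Q(w) = w₁²`, `w₁ ≠ 0`; the lines are `∞` and the single root of `w₂ + a w₁ = 0`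
    have hw1 : w 1 ≠ 0 := by
      intro h1; apply hw; rw [hQ, hw0, h1]; ring
    have hroot : ∀ a : k, (2 * w 2 + 2 * a * w 1 = 0) ↔ a = -w 2 / w 1 := fun a => by
      rw [eq_div_iff hw1]
      constructor
      · intro h
        have h' : (2 : k) * (a * w 1 + w 2) = 0 := by linear_combination h
        linear_combination (mul_eq_zero.1 h').resolve_left h2
      · intro h; linear_combination 2 * h
    rw [if_pos hw0]
    simp_rw [hw0, mul_zero, sub_zero, zero_mul, zero_add]
    simp only [hroot, Finset.sum_ite_eq', Finset.mem_univ, if_true, map_pow, quadraticChar_sq_one hw1]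
    try norm_num
  · -- `w₀ ≠ 0`: no line at `∞`; complete the square `2w₂ + 2a w₁ − a² w₀ = 0 ⟺ (a − w₁∕w₀)² = Q(w)∕w₀²`
    have hiff : ∀ a : k, (2 * w 2 + 2 * a * w 1 - a ^ 2 * w 0 = 0) ↔ (a - w 1 / w 0) ^ 2 = (2 * w 0 * w 2 + w 1 ^ 2) / w 0 ^ 2 := fun a => by
      have e1 : a - w 1 / w 0 = (a * w 0 - w 1) / w 0 := by field_simp
      rw [e1, div_pow, div_left_inj' (pow_ne_zero 2 hw0)]
      constructor
      · intro h; linear_combination (-w 0) * h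
      · intro h
        have h' : w 0 * (2 * w 2 + 2 * a * w 1 - a ^ 2 * w 0) = 0 := by linear_combination -h
        exact (mul_eq_zero.1 h').resolve_left hw0
    have hcount : (∑ a : k, (if 2 * w 2 + 2 * a * w 1 - a ^ 2 * w 0 = 0 then (1 : ℤ) else 0)) =
        ∑ z : k, (if z ^ 2 = (2 * w 0 * w 2 + w 1 ^ 2) / w 0 ^ 2 then (1 : ℤ) else 0) := by
      refine Fintype.sum_equiv (Equiv.subRight (w 1 / w 0)) _ _ fun a => ?_
      simp only [Equiv.subRight_apply, hiff a]
    rw [if_neg hw0, zero_add, hcount, sum_ite_sq_eq_eq hk, div_eq_mul_inv, ← inv_pow, map_mul, map_pow, quadraticChar_sq_one (inv_ne_zero hw0),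
      mul_one]
    ring

/-- **HYPERBOLIC WITNESS ⇒ TWO LINES**: if some non-zero isotropic vector is orthogonal to the anisotropic `w`, then `w^⊥` is hyperbolic and EXACTLY `2` isotropic lines are
orthogonal to `w`. [cite: Wilson2009, §3.7.1 p. 70] [cite: BruhatTits1972, §10] -/
theorem natCard_params_orthogonal_eq_two (hk : ringChar k ≠ 2) {w : Fin 3 → k} (hw : w ⬝ᵥ (((StdForm.antidiagonal 3).over k) *ᵥ w) ≠ 0)
    {z : Fin 3 → k} (hz0 : z ≠ 0) (hz : z ⬝ᵥ (((StdForm.antidiagonal 3).over k) *ᵥ z) = 0) (hzw : z ⬝ᵥ (((StdForm.antidiagonal 3).over k) *ᵥ w) = 0) :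
    Nat.card {p : Option {p : k × k // p.2 + (RingHom.id k) p.2 + p.1 * (RingHom.id k) p.1 = 0} //
        (p.elim (Pi.single 2 1) fun q => ![(1 : k), q.1.1, q.1.2]) ⬝ᵥ (((StdForm.antidiagonal 3).over k) *ᵥ w) = 0} = 2 := by
  have hcount := natCard_params_orthogonal_eq hk hw
  -- the witness gives a line: `z = c • x̄_p`
  obtain ⟨c, hc, p, rfl⟩ := exists_smul_normalParam_eq_of_isotropic hz0 hz
  have hp : (p.elim (Pi.single 2 1) fun q => ![(1 : k), q.1.1, q.1.2]) ⬝ᵥ (((StdForm.antidiagonal 3).over k) *ᵥ w) = 0 := by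
    rw [smul_dotProduct, smul_eq_mul] at hzw
    exact (mul_eq_zero.1 hzw).resolve_left hc
  have hpos : 0 < Nat.card {p : Option {p : k × k // p.2 + (RingHom.id k) p.2 + p.1 * (RingHom.id k) p.1 = 0} //
      (p.elim (Pi.single 2 1) fun q => ![(1 : k), q.1.1, q.1.2]) ⬝ᵥ (((StdForm.antidiagonal 3).over k) *ᵥ w) = 0} :=
    Nat.card_pos_iff.2 ⟨⟨⟨p, hp⟩⟩, inferInstance⟩
  -- so `χ(Q(w)) ≥ 0`, and `χ(Q(w)) = ±1`
  rcases quadraticChar_dichotomy hw with hχ | hχ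
  · rw [hχ] at hcount; omega
  · rw [hχ] at hcount; omega

omit [Fintype k] [DecidableEq k] in
/-- **END CONFIGURATION ⇒ ONE LINE**: if `m ≠ 0` is isotropic and orthogonal to `w`, then the only isotropic line orthogonal to BOTH `w` and `m` is the line of `m`
(distinct isotropic lines are never orthogonal; `char k ≠ 2`). [cite: Wilson2009, §3.7.1 p. 70] [cite: BruhatTits1972, §10] -/
theorem natCard_params_orthogonal_orthogonal_eq_one [Finite k] (hk : ringChar k ≠ 2) (w : Fin 3 → k)
    {m : Fin 3 → k} (hm0 : m ≠ 0) (hm : m ⬝ᵥ (((StdForm.antidiagonal 3).over k) *ᵥ m) = 0) (hmw : m ⬝ᵥ (((StdForm.antidiagonal 3).over k) *ᵥ w) = 0) :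
    Nat.card {p : Option {p : k × k // p.2 + (RingHom.id k) p.2 + p.1 * (RingHom.id k) p.1 = 0} //
        (p.elim (Pi.single 2 1) fun q => ![(1 : k), q.1.1, q.1.2]) ⬝ᵥ (((StdForm.antidiagonal 3).over k) *ᵥ w) = 0 ∧
        (p.elim (Pi.single 2 1) fun q => ![(1 : k), q.1.1, q.1.2]) ⬝ᵥ (((StdForm.antidiagonal 3).over k) *ᵥ m) = 0} = 1 := by
  have h2 : (2 : k) ≠ 0 := Ring.two_ne_zero hk
  obtain ⟨c, hc, pm, rfl⟩ := exists_smul_normalParam_eq_of_isotropic hm0 hm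
  have hpm : (pm.elim (Pi.single 2 1) fun q => ![(1 : k), q.1.1, q.1.2]) ⬝ᵥ (((StdForm.antidiagonal 3).over k) *ᵥ w) = 0 := by
    rw [smul_dotProduct, smul_eq_mul] at hmw
    exact (mul_eq_zero.1 hmw).resolve_left hc
  -- orthogonality to the line of `m` singles out `pm`
  have hkey : ∀ p : Option {p : k × k // p.2 + (RingHom.id k) p.2 + p.1 * (RingHom.id k) p.1 = 0},
      (p.elim (Pi.single 2 1) fun q => ![(1 : k), q.1.1, q.1.2]) ⬝ᵥ
          (((StdForm.antidiagonal 3).over k) *ᵥ (c • (pm.elim (Pi.single 2 1) fun q => ![(1 : k), q.1.1, q.1.2]))) = 0 ↔ p = pm := fun p => by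
    rw [Matrix.mulVec_smul, dotProduct_smul, smul_eq_mul, mul_eq_zero, or_iff_right hc,
      normalParam_dotProduct_mulVec_normalParam_eq_zero_iff h2]
  rw [Nat.card_eq_one_iff_exists]
  exact ⟨⟨pm, hpm, (hkey pm).2 rfl⟩, fun q => Subtype.ext ((hkey q.1).1 q.2.2)⟩

end FiniteField


open Literature.NumberTheory.Automorphic Literature.NumberTheory.Automorphic.HermitianLattice
open Literature.NumberTheory.Automorphic.CartanUnique Literature.NumberTheory.Automorphic.UnitaryGroup
open Literature.GroupTheory.SpecificGroups

section Lattice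

variable {K : Type*} [Field K] [Valued K ℤᵐ⁰] {σ : K →+* K} {ϖ : K}

/-! ## §2 Residual reading of a LINEAR test and the bridge for the children of a vertex -/

/-- **RESIDUAL READING OF A LINEAR TEST**: for `x, y ∈ 𝒪³`, `|B₀(x, y)| < 1 ↔ ᵗx̄ J̄₀ ȳ = 0` (`σ̄ = id`; ★ `v_B₀_self_lt_one_iff_residue` is the case `y = x`).
[cite: BruhatTits1972, §10] [cite: Tits1979, §3.5] -/
theorem v_B₀_lt_one_iff_residue (hvσ : ∀ a, Valued.v (σ a) = Valued.v a) (hres : ∀ x : K, Valued.v x ≤ 1 → Valued.v (σ x - x) < 1)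
    (x₀ y₀ : Fin 3 → 𝒪[K]) :
    Valued.v (B₀ σ 3 (fun i => (x₀ i : K)) (fun i => (y₀ i : K))) < 1 ↔
      (fun i => IsLocalRing.residue 𝒪[K] (x₀ i)) ⬝ᵥ (((StdForm.antidiagonal 3).over 𝓀[K]) *ᵥ (fun i => IsLocalRing.residue 𝒪[K] (y₀ i))) = 0 := by
  have hcoe : B₀ σ 3 (fun i => (x₀ i : K)) (fun i => (y₀ i : K)) =
      ((∑ i, (⟨σ (x₀ i : K), map_coe_mem_integer hvσ (x₀ i)⟩ : 𝒪[K]) * y₀ (Fin.rev i) : 𝒪[K]) : K) := by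
    rw [B₀_apply]; push_cast; rfl
  rw [hcoe, ← residue_eq_zero_iff_v_lt_one, map_sum, dotProduct_antidiagonal_three_mulVec_eq_sum]
  simp only [map_mul, residue_map_sigma_eq hvσ hres]

/-- **The linear test at the normalised representative `x_p` reads residually at `x̄_p`**: `|B₀(x_p, y)| < 1 ↔ ᵗx̄_p J̄₀ ȳ = 0` for `y ∈ 𝒪³`
(`x_∞ = e₂`, `x_(ā,b̄) = (1, lift ā, lift b̄)`). [cite: BruhatTits1972, §10] [cite: Serre1980Trees, II.1.1] -/
theorem v_B₀_normalForm_lt_one_iff_residue (hvσ : ∀ a, Valued.v (σ a) = Valued.v a) (hres : ∀ x : K, Valued.v x ≤ 1 → Valued.v (σ x - x) < 1)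
    (lift : 𝓀[K] → 𝒪[K]) (hlift : ∀ a, IsLocalRing.residue 𝒪[K] (lift a) = a)
    (p : Option {p : 𝓀[K] × 𝓀[K] // p.2 + (RingHom.id 𝓀[K]) p.2 + p.1 * (RingHom.id 𝓀[K]) p.1 = 0}) (y₀ : Fin 3 → 𝒪[K]) :
    Valued.v (B₀ σ 3 (p.elim (Pi.single 2 1) fun q => ![(1 : K), (lift q.1.1 : K), (lift q.1.2 : K)]) (fun i => (y₀ i : K))) < 1 ↔
      (p.elim (Pi.single 2 1) fun q => ![(1 : 𝓀[K]), q.1.1, q.1.2]) ⬝ᵥ (((StdForm.antidiagonal 3).over 𝓀[K]) *ᵥ (fun i => IsLocalRing.residue 𝒪[K] (y₀ i))) = 0 := by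
  let xO : Fin 3 → 𝒪[K] := p.elim (Pi.single 2 1) fun q => ![(1 : 𝒪[K]), lift q.1.1, lift q.1.2]
  have hxO : (fun i => ((xO i : 𝒪[K]) : K)) = p.elim (Pi.single 2 1) fun q => ![(1 : K), (lift q.1.1 : K), (lift q.1.2 : K)] := by
    rcases p with _ | q
    · funext i; change ((((Pi.single 2 1 : Fin 3 → 𝒪[K]) i) : 𝒪[K]) : K) = (Pi.single 2 1 : Fin 3 → K) i
      fin_cases i <;> simp
    · funext i; change (((![(1 : 𝒪[K]), lift q.1.1, lift q.1.2] : Fin 3 → 𝒪[K]) i : 𝒪[K]) : K) = (![(1 : K), (lift q.1.1 : K), (lift q.1.2 : K)] : Fin 3 → K) i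
      fin_cases i <;> simp
  have hxObar : (fun i => IsLocalRing.residue 𝒪[K] (xO i)) = (p.elim (Pi.single 2 1) fun q => ![(1 : 𝓀[K]), q.1.1, q.1.2]) := by
    rcases p with _ | q
    · funext i; change IsLocalRing.residue 𝒪[K] ((Pi.single 2 1 : Fin 3 → 𝒪[K]) i) = (Pi.single 2 1 : Fin 3 → 𝓀[K]) i
      fin_cases i <;> simp
    · funext i; change IsLocalRing.residue 𝒪[K] ((![(1 : 𝒪[K]), lift q.1.1, lift q.1.2] : Fin 3 → 𝒪[K]) i) = (![(1 : 𝓀[K]), q.1.1, q.1.2] : Fin 3 → 𝓀[K]) i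
      fin_cases i <;> simp [hlift]
  rw [← hxO, v_B₀_lt_one_iff_residue hvσ hres xO y₀, hxObar]

/-- **THE LINEAR BRIDGE AT THE ROOT.**  For two integral test vectors `y₁ y₂ ∈ 𝒪³`: the neighbours `w = κ·N₁` (`κ ∈ K₀`) of the root `L₀` whose line `κe₀` passes the LINEAR
tests `|B₀(κe₀, y₁)| < 1 ∧ |B₀(κe₀, y₂)| < 1` (for SOME, equivalently ANY, frame `κ`) are counted by the normalised isotropic parameters `p` with `ᵗx̄_p J̄₀ ȳ₁ = 0 ∧ ᵗx̄_p J̄₀ ȳ₂ = 0`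
(★ R2b's bijection `p ↦ N_{x_p}`, exactly as ★ G3⁗ `ncard_neighborSet_root_pred_eq_natCard`; the linear test is frame-independent by the residual-hyperplane dictionary).
[cite: BruhatTits1972, §10] [cite: Tits1979, §2.4, §3.5] [cite: Serre1980Trees, II.1.1] [cite: Kottwitz1986, §3] -/
theorem ncard_neighborSet_root_linTest_eq_natCard (hσ : ∀ x, σ (σ x) = x) (hvσ : ∀ a, Valued.v (σ a) = Valued.v a) (hσϖ : σ ϖ = -ϖ)
    (hϖ : Valued.v ϖ = WithZero.exp (-1 : ℤ)) (hres : ∀ x : K, Valued.v x ≤ 1 → Valued.v (σ x - x) < 1) (h2 : Valued.v (2 : K) = 1) [Finite 𝓀[K]]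
    (y₁ y₂ : Fin 3 → 𝒪[K]) :
    {w | w ∈ (latticeGraph σ ϖ ((StdForm.antidiagonal 3).over K)).neighborSet ⟨stdLattice K 3, 0, isSelfDualLattice_stdLattice_three_of_v hϖ⟩ ∧
        ∃ κ : unitaryGroupOfForm σ ((StdForm.antidiagonal 3).over K), κ ∈ unitaryInt σ ((StdForm.antidiagonal 3).over K) ∧
          w.1 = mapGL (κ : GL (Fin 3) K) (latt (Matrix.diagonal ![(1 : K), 1, ϖ])) ∧
          Valued.v (B₀ σ 3 (((κ : GL (Fin 3) K) : Matrix (Fin 3) (Fin 3) K) *ᵥ (Pi.single 0 1)) (fun i => (y₁ i : K))) < 1 ∧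
          Valued.v (B₀ σ 3 (((κ : GL (Fin 3) K) : Matrix (Fin 3) (Fin 3) K) *ᵥ (Pi.single 0 1)) (fun i => (y₂ i : K))) < 1}.ncard =
      Nat.card {p : Option {p : 𝓀[K] × 𝓀[K] // p.2 + (RingHom.id 𝓀[K]) p.2 + p.1 * (RingHom.id 𝓀[K]) p.1 = 0} //
        (p.elim (Pi.single 2 1) fun q => ![(1 : 𝓀[K]), q.1.1, q.1.2]) ⬝ᵥ (((StdForm.antidiagonal 3).over 𝓀[K]) *ᵥ (fun i => IsLocalRing.residue 𝒪[K] (y₁ i))) = 0 ∧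
        (p.elim (Pi.single 2 1) fun q => ![(1 : 𝓀[K]), q.1.1, q.1.2]) ⬝ᵥ (((StdForm.antidiagonal 3).over 𝓀[K]) *ᵥ (fun i => IsLocalRing.residue 𝒪[K] (y₂ i))) = 0} := by
  classical
  have hϖ0 : ϖ ≠ 0 := uniformizer_ne_zero hϖ
  have hlt1 : ∀ z : K, Valued.v z < 1 ↔ Valued.v z ≤ Valued.v ϖ := fun z => by rw [hϖ]; exact v_lt_one_iff z
  have h20 : (2 : K) ≠ 0 := fun h => by rw [h, map_zero] at h2; exact zero_ne_one h2
  have htrace : ∃ t : K, Valued.v t ≤ 1 ∧ t + σ t = 1 :=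
    ⟨2⁻¹, by rw [map_inv₀, h2, inv_one], by rw [map_inv₀, map_ofNat]; field_simp; norm_num⟩
  have hN₁ := isVertexLattice_two_N₁_of_neg (σ := σ) hσϖ hϖ
  obtain ⟨lift, hlift⟩ : ∃ lift : 𝓀[K] → 𝒪[K], ∀ a, IsLocalRing.residue 𝒪[K] (lift a) = a :=
    ⟨Function.surjInv IsLocalRing.residue_surjective, Function.surjInv_eq IsLocalRing.residue_surjective⟩
  have hσO : ∀ x : 𝒪[K], σ x ∈ 𝒪[K] := map_coe_mem_integer hvσ
  have hσk : ∀ y : 𝒪[K], IsLocalRing.residue 𝒪[K] ⟨σ y, hσO y⟩ = (RingHom.id 𝓀[K]) (IsLocalRing.residue 𝒪[K] y) :=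
    fun y => by rw [RingHom.id_apply]; exact residue_map_sigma_eq hvσ hres y
  -- the normalised vectors over `K`
  let xOf : Option {p : 𝓀[K] × 𝓀[K] // p.2 + (RingHom.id 𝓀[K]) p.2 + p.1 * (RingHom.id 𝓀[K]) p.1 = 0} → (Fin 3 → K) := fun p =>
    p.elim (Pi.single 2 1) fun q => ![(1 : K), (lift q.1.1 : K), (lift q.1.2 : K)]
  have hxOf : ∀ p, xOf p = p.elim (Pi.single 2 1) fun q => ![(1 : K), (lift q.1.1 : K), (lift q.1.2 : K)] := fun _ => rfl
  have hxOf_none : xOf none = Pi.single 2 1 := rfl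
  have hxOf_some : ∀ q, xOf (some q) = ![(1 : K), (lift q.1.1 : K), (lift q.1.2 : K)] := fun _ => rfl
  have hxL : ∀ p, xOf p ∈ stdLattice K 3 := by
    rintro (_ | q)
    · rw [hxOf_none]; exact single_mem_stdLattice 2
    · rw [hxOf_some]; exact vec_mem_stdLattice _ _
  have hxu : ∀ p, ∃ j, Valued.v (xOf p j) = 1 := by
    rintro (_ | q)
    · exact ⟨2, by rw [hxOf_none]; simp⟩
    · exact ⟨0, by rw [hxOf_some]; simp⟩
  have hxiso : ∀ p, Valued.v (B₀ σ 3 (xOf p) (xOf p)) < 1 := by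
    rintro (_ | q)
    · rw [hxOf_none, B₀_single_left, show Fin.rev (2 : Fin 3) = 0 from rfl]; simp
    · rw [hxOf_some]
      refine v_B₀_vec_self_lt_one hσO (RingHom.id 𝓀[K]) hσk ?_
      rw [hlift, hlift]; exact q.2
  -- the vertices `N_{x_p}` (★ R2b)
  choose f hf using fun p => exists_mem_neighborSet_root_forall_mem_iff_of_trace hσ hvσ hϖ htrace hN₁ (hxL p) (hxu p) (hxiso p)
  have hfiff : ∀ p, ∀ y ∈ stdLattice K 3, (y ∈ (f p).1 ↔ Valued.v (B₀ σ 3 (xOf p) y) < 1) := fun p y hy => by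
    rw [(hf p).2 y]; exact ⟨fun h => h.2, fun h => ⟨hy, h⟩⟩
  -- injectivity of `p ↦ f p`
  have hinj : ∀ p p', f p = f p' → p = p' := by
    intro p p' hEq
    refine normalForm_eq_of_forall_v_B₀_lt_one_iff hvσ (RingHom.id 𝓀[K]) lift hlift fun y hy => ?_
    rw [← hxOf, ← hxOf, ← hfiff p y hy, ← hfiff p' y hy, hEq]
  -- surjectivity of `p ↦ f p`
  have hsurj : ∀ w ∈ (latticeGraph σ ϖ ((StdForm.antidiagonal 3).over K)).neighborSet ⟨stdLattice K 3, 0, isSelfDualLattice_stdLattice_three_of_v hϖ⟩, ∃ p, f p = w := by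
    intro w hw
    obtain ⟨x, hx, hunit, hiso, hmem⟩ := exists_isotropic_forall_mem_iff_of_mem_neighborSet_root_of_trace hσ hvσ hϖ htrace hN₁ hw
    have key : ∀ p, (∃ c : K, Valued.v c = 1 ∧ ∀ i, Valued.v (x i - c * xOf p i) < 1) → f p = w := fun p hc => by
      refine eq_of_forall_mem_iff fun y => ?_
      rw [(hf p).2 y, hmem y]
      exact and_congr_right fun hy => (forall_v_B₀_lt_one_iff_of_exists_unit_congr hvσ hc y hy).symm
    rcases exists_unit_congr_normalForm_of_isotropic_of_v hvσ hσO (RingHom.id 𝓀[K]) hσk lift hlift hx hunit hiso with hc | ⟨p, hc⟩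
    · exact ⟨none, key none (by rw [hxOf_none]; exact hc)⟩
    · exact ⟨some p, key (some p) (by rw [hxOf_some]; exact hc)⟩
  -- the hyperplane of a frame `κ` of `f p` is that of `x_p`
  have hframe : ∀ p (κ : unitaryGroupOfForm σ ((StdForm.antidiagonal 3).over K)), κ ∈ unitaryInt σ ((StdForm.antidiagonal 3).over K) →
      (f p).1 = mapGL (κ : GL (Fin 3) K) (latt (Matrix.diagonal ![(1 : K), 1, ϖ])) →
      ∀ y ∈ stdLattice K 3, (Valued.v (B₀ σ 3 (((κ : GL (Fin 3) K) : Matrix (Fin 3) (Fin 3) K) *ᵥ (Pi.single 0 1)) y) < 1 ↔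
        Valued.v (B₀ σ 3 (p.elim (Pi.single 2 1) fun q => ![(1 : K), (lift q.1.1 : K), (lift q.1.2 : K)]) y) < 1) := by
    intro p κ hκ hwκ y hy
    have hwx' : y ∈ (f p).1 ↔ Valued.v (B₀ σ 3 (((κ : GL (Fin 3) K) : Matrix (Fin 3) (Fin 3) K) *ᵥ (Pi.single 0 1)) y) < 1 := by
      rw [hwκ, mem_mapGL_N₁_iff hκ hϖ0 hy, hlt1]
    rw [← hwx', ← hxOf, hfiff p y hy]
  -- the test vectors are integral
  have hy₁ : (fun i => (y₁ i : K)) ∈ stdLattice K 3 := fun i => (y₁ i).2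
  have hy₂ : (fun i => (y₂ i : K)) ∈ stdLattice K 3 := fun i => (y₂ i).2
  -- KEY: `f p` passes the linear tests (in some frame) iff `x̄_p ⊥ ȳ₁, ȳ₂`
  have hkey : ∀ p, (∃ κ : unitaryGroupOfForm σ ((StdForm.antidiagonal 3).over K), κ ∈ unitaryInt σ ((StdForm.antidiagonal 3).over K) ∧
        (f p).1 = mapGL (κ : GL (Fin 3) K) (latt (Matrix.diagonal ![(1 : K), 1, ϖ])) ∧
        Valued.v (B₀ σ 3 (((κ : GL (Fin 3) K) : Matrix (Fin 3) (Fin 3) K) *ᵥ (Pi.single 0 1)) (fun i => (y₁ i : K))) < 1 ∧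
        Valued.v (B₀ σ 3 (((κ : GL (Fin 3) K) : Matrix (Fin 3) (Fin 3) K) *ᵥ (Pi.single 0 1)) (fun i => (y₂ i : K))) < 1) ↔
      ((p.elim (Pi.single 2 1) fun q => ![(1 : 𝓀[K]), q.1.1, q.1.2]) ⬝ᵥ (((StdForm.antidiagonal 3).over 𝓀[K]) *ᵥ (fun i => IsLocalRing.residue 𝒪[K] (y₁ i))) = 0 ∧
        (p.elim (Pi.single 2 1) fun q => ![(1 : 𝓀[K]), q.1.1, q.1.2]) ⬝ᵥ (((StdForm.antidiagonal 3).over 𝓀[K]) *ᵥ (fun i => IsLocalRing.residue 𝒪[K] (y₂ i))) = 0) := by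
    intro p
    rw [← v_B₀_normalForm_lt_one_iff_residue hvσ hres lift hlift p y₁, ← v_B₀_normalForm_lt_one_iff_residue hvσ hres lift hlift p y₂, ← hxOf]
    constructor
    · rintro ⟨κ, hκ, hwκ, h₁, h₂⟩
      exact ⟨(hframe p κ hκ hwκ _ hy₁).1 h₁, (hframe p κ hκ hwκ _ hy₂).1 h₂⟩
    · rintro ⟨h₁, h₂⟩
      obtain ⟨κ, hκ, hwκ⟩ := (mem_neighborSet_root_iff_exists_mem_unitaryInt_of_trace hσ hvσ hϖ htrace hN₁ (f p)).1 (hf p).1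
      exact ⟨κ, hκ, hwκ, (hframe p κ hκ hwκ _ hy₁).2 h₁, (hframe p κ hκ hwκ _ hy₂).2 h₂⟩
  -- the restricted bijection
  rw [← Nat.card_coe_set_eq]
  refine (Nat.card_congr (Equiv.ofBijective
    (fun p : {p : Option {p : 𝓀[K] × 𝓀[K] // p.2 + (RingHom.id 𝓀[K]) p.2 + p.1 * (RingHom.id 𝓀[K]) p.1 = 0} //
        (p.elim (Pi.single 2 1) fun q => ![(1 : 𝓀[K]), q.1.1, q.1.2]) ⬝ᵥ (((StdForm.antidiagonal 3).over 𝓀[K]) *ᵥ (fun i => IsLocalRing.residue 𝒪[K] (y₁ i))) = 0 ∧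
        (p.elim (Pi.single 2 1) fun q => ![(1 : 𝓀[K]), q.1.1, q.1.2]) ⬝ᵥ (((StdForm.antidiagonal 3).over 𝓀[K]) *ᵥ (fun i => IsLocalRing.residue 𝒪[K] (y₂ i))) = 0} =>
      (⟨f p.1, (hf p.1).1, (hkey p.1).2 p.2⟩ :
        {w | w ∈ (latticeGraph σ ϖ ((StdForm.antidiagonal 3).over K)).neighborSet ⟨stdLattice K 3, 0, isSelfDualLattice_stdLattice_three_of_v hϖ⟩ ∧
          ∃ κ : unitaryGroupOfForm σ ((StdForm.antidiagonal 3).over K), κ ∈ unitaryInt σ ((StdForm.antidiagonal 3).over K) ∧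
            w.1 = mapGL (κ : GL (Fin 3) K) (latt (Matrix.diagonal ![(1 : K), 1, ϖ])) ∧
            Valued.v (B₀ σ 3 (((κ : GL (Fin 3) K) : Matrix (Fin 3) (Fin 3) K) *ᵥ (Pi.single 0 1)) (fun i => (y₁ i : K))) < 1 ∧
            Valued.v (B₀ σ 3 (((κ : GL (Fin 3) K) : Matrix (Fin 3) (Fin 3) K) *ᵥ (Pi.single 0 1)) (fun i => (y₂ i : K))) < 1}))
    ⟨?_, ?_⟩)).symm
  · intro p p' hpp'
    exact Subtype.ext (hinj _ _ (congrArg Subtype.val hpp'))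
  · rintro ⟨w, hw, hpass⟩
    obtain ⟨p, hp⟩ := hsurj w hw
    refine ⟨⟨p, (hkey p).1 (by rw [hp]; exact hpass)⟩, Subtype.ext hp⟩

/-- **THE LINEAR BRIDGE AT A GENERAL SELF-DUAL VERTEX `v = u·L₀`** (transport of the root statement along `u`, as ★ G3⁗ §2): the children of `u·L₀` are the `(uκ)·N₁`,
`κ ∈ K₀`, and the linear tests are read as `|⟨(uκ)e₀, u·y⟩| < 1` for test vectors `u·y`, `y ∈ 𝒪³` (the consumer's `u·y₁ = A e_{i₀}`, `u·y₂ = ϖ^{s′}·A e_k` of ★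
`lev_iff_v_pairing_lt_one_of_adj_keyed`; `⟨u x, u y⟩ = ⟨x, y⟩ = B₀(x, y)` by unitarity, ★ `pairing_antidiagonal`). [cite: BruhatTits1972, §10] [cite: Tits1979, §3.5] [cite: Kottwitz1986, §3] -/
theorem ncard_neighborSet_linTest_eq_natCard (hσ : ∀ x, σ (σ x) = x) (hvσ : ∀ a, Valued.v (σ a) = Valued.v a) (hσϖ : σ ϖ = -ϖ)
    (hϖ : Valued.v ϖ = WithZero.exp (-1 : ℤ)) (hres : ∀ x : K, Valued.v x ≤ 1 → Valued.v (σ x - x) < 1) (h2 : Valued.v (2 : K) = 1) [Finite 𝓀[K]]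
    (u : unitaryGroupOfForm σ ((StdForm.antidiagonal 3).over K)) (y₁ y₂ : Fin 3 → 𝒪[K]) :
    {c | c ∈ (latticeGraph σ ϖ ((StdForm.antidiagonal 3).over K)).neighborSet
          (latticeGraphIso σ ϖ ((StdForm.antidiagonal 3).over K) u ⟨stdLattice K 3, 0, isSelfDualLattice_stdLattice_three_of_v hϖ⟩) ∧
        ∃ κ : unitaryGroupOfForm σ ((StdForm.antidiagonal 3).over K), κ ∈ unitaryInt σ ((StdForm.antidiagonal 3).over K) ∧
          c.1 = mapGL (((u * κ : unitaryGroupOfForm σ ((StdForm.antidiagonal 3).over K)) : GL (Fin 3) K)) (latt (Matrix.diagonal ![(1 : K), 1, ϖ])) ∧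
          Valued.v (pairing σ ((StdForm.antidiagonal 3).over K) ((((u * κ : unitaryGroupOfForm σ ((StdForm.antidiagonal 3).over K)) : GL (Fin 3) K) : Matrix (Fin 3) (Fin 3) K) *ᵥ (Pi.single 0 1)) (((u : GL (Fin 3) K) : Matrix (Fin 3) (Fin 3) K) *ᵥ (fun i => (y₁ i : K)))) < 1 ∧
          Valued.v (pairing σ ((StdForm.antidiagonal 3).over K) ((((u * κ : unitaryGroupOfForm σ ((StdForm.antidiagonal 3).over K)) : GL (Fin 3) K) : Matrix (Fin 3) (Fin 3) K) *ᵥ (Pi.single 0 1)) (((u : GL (Fin 3) K) : Matrix (Fin 3) (Fin 3) K) *ᵥ (fun i => (y₂ i : K)))) < 1}.ncard =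
      Nat.card {p : Option {p : 𝓀[K] × 𝓀[K] // p.2 + (RingHom.id 𝓀[K]) p.2 + p.1 * (RingHom.id 𝓀[K]) p.1 = 0} //
        (p.elim (Pi.single 2 1) fun q => ![(1 : 𝓀[K]), q.1.1, q.1.2]) ⬝ᵥ (((StdForm.antidiagonal 3).over 𝓀[K]) *ᵥ (fun i => IsLocalRing.residue 𝒪[K] (y₁ i))) = 0 ∧
        (p.elim (Pi.single 2 1) fun q => ![(1 : 𝓀[K]), q.1.1, q.1.2]) ⬝ᵥ (((StdForm.antidiagonal 3).over 𝓀[K]) *ᵥ (fun i => IsLocalRing.residue 𝒪[K] (y₂ i))) = 0} := by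
  rw [← ncard_neighborSet_root_linTest_eq_natCard hσ hvσ hσϖ hϖ hres h2 y₁ y₂]
  have hmul : ∀ κ : unitaryGroupOfForm σ ((StdForm.antidiagonal 3).over K),
      mapGL (((u * κ : unitaryGroupOfForm σ ((StdForm.antidiagonal 3).over K)) : GL (Fin 3) K)) (latt (Matrix.diagonal ![(1 : K), 1, ϖ])) =
        mapGL (u : GL (Fin 3) K) (mapGL (κ : GL (Fin 3) K) (latt (Matrix.diagonal ![(1 : K), 1, ϖ]))) := fun κ => by
    rw [Subgroup.coe_mul, mapGL_mul]
  have hinvmul : ∀ X : Submodule 𝒪[K] (Fin 3 → K), mapGL ((u⁻¹ : unitaryGroupOfForm σ ((StdForm.antidiagonal 3).over K)) : GL (Fin 3) K) (mapGL (u : GL (Fin 3) K) X) = X :=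
    fun X => by rw [← mapGL_mul, Subgroup.coe_inv, inv_mul_cancel, mapGL_one]
  -- the pairing `⟨(uκ)e₀, u y⟩ = B₀(κe₀, y)`
  have hpair : ∀ (κ : unitaryGroupOfForm σ ((StdForm.antidiagonal 3).over K)) (y : Fin 3 → 𝒪[K]),
      pairing σ ((StdForm.antidiagonal 3).over K) ((((u * κ : unitaryGroupOfForm σ ((StdForm.antidiagonal 3).over K)) : GL (Fin 3) K) : Matrix (Fin 3) (Fin 3) K) *ᵥ (Pi.single 0 1)) (((u : GL (Fin 3) K) : Matrix (Fin 3) (Fin 3) K) *ᵥ (fun i => (y i : K))) = B₀ σ 3 (((κ : GL (Fin 3) K) : Matrix (Fin 3) (Fin 3) K) *ᵥ (Pi.single 0 1)) (fun i => (y i : K)) := fun κ y => by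
    rw [Subgroup.coe_mul, Units.val_mul, ← Matrix.mulVec_mulVec, pairing_mulVec_mulVec_of_mem_unitary u.2, pairing_antidiagonal]
  have himage : {c | c ∈ (latticeGraph σ ϖ ((StdForm.antidiagonal 3).over K)).neighborSet
          (latticeGraphIso σ ϖ ((StdForm.antidiagonal 3).over K) u ⟨stdLattice K 3, 0, isSelfDualLattice_stdLattice_three_of_v hϖ⟩) ∧
        ∃ κ : unitaryGroupOfForm σ ((StdForm.antidiagonal 3).over K), κ ∈ unitaryInt σ ((StdForm.antidiagonal 3).over K) ∧
          c.1 = mapGL (((u * κ : unitaryGroupOfForm σ ((StdForm.antidiagonal 3).over K)) : GL (Fin 3) K)) (latt (Matrix.diagonal ![(1 : K), 1, ϖ])) ∧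
          Valued.v (pairing σ ((StdForm.antidiagonal 3).over K) ((((u * κ : unitaryGroupOfForm σ ((StdForm.antidiagonal 3).over K)) : GL (Fin 3) K) : Matrix (Fin 3) (Fin 3) K) *ᵥ (Pi.single 0 1)) (((u : GL (Fin 3) K) : Matrix (Fin 3) (Fin 3) K) *ᵥ (fun i => (y₁ i : K)))) < 1 ∧
          Valued.v (pairing σ ((StdForm.antidiagonal 3).over K) ((((u * κ : unitaryGroupOfForm σ ((StdForm.antidiagonal 3).over K)) : GL (Fin 3) K) : Matrix (Fin 3) (Fin 3) K) *ᵥ (Pi.single 0 1)) (((u : GL (Fin 3) K) : Matrix (Fin 3) (Fin 3) K) *ᵥ (fun i => (y₂ i : K)))) < 1} =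
      latticeGraphIso σ ϖ ((StdForm.antidiagonal 3).over K) u ''
        {w | w ∈ (latticeGraph σ ϖ ((StdForm.antidiagonal 3).over K)).neighborSet ⟨stdLattice K 3, 0, isSelfDualLattice_stdLattice_three_of_v hϖ⟩ ∧
          ∃ κ : unitaryGroupOfForm σ ((StdForm.antidiagonal 3).over K), κ ∈ unitaryInt σ ((StdForm.antidiagonal 3).over K) ∧
            w.1 = mapGL (κ : GL (Fin 3) K) (latt (Matrix.diagonal ![(1 : K), 1, ϖ])) ∧
            Valued.v (B₀ σ 3 (((κ : GL (Fin 3) K) : Matrix (Fin 3) (Fin 3) K) *ᵥ (Pi.single 0 1)) (fun i => (y₁ i : K))) < 1 ∧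
            Valued.v (B₀ σ 3 (((κ : GL (Fin 3) K) : Matrix (Fin 3) (Fin 3) K) *ᵥ (Pi.single 0 1)) (fun i => (y₂ i : K))) < 1} := by
    ext c
    simp only [Set.mem_setOf_eq, Set.mem_image, SimpleGraph.mem_neighborSet]
    constructor
    · rintro ⟨hadj, κ, hκ, hcκ, ht₁, ht₂⟩
      have hc : latticeGraphIso σ ϖ ((StdForm.antidiagonal 3).over K) u (latticeGraphIso σ ϖ ((StdForm.antidiagonal 3).over K) u⁻¹ c) = c :=
        latticeGraphIso_mul_inv_apply u c
      refine ⟨latticeGraphIso σ ϖ ((StdForm.antidiagonal 3).over K) u⁻¹ c, ⟨?_, κ, hκ, ?_, ?_, ?_⟩, hc⟩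
      · rw [← hc] at hadj
        exact (latticeGraphIso σ ϖ ((StdForm.antidiagonal 3).over K) u).map_adj_iff.1 hadj
      · rw [latticeGraphIso_apply_val, hcκ, hmul, hinvmul]
      · rw [← hpair κ y₁]; exact ht₁
      · rw [← hpair κ y₂]; exact ht₂
    · rintro ⟨w, ⟨hadj, κ, hκ, hwκ, ht₁, ht₂⟩, rfl⟩
      refine ⟨(latticeGraphIso σ ϖ ((StdForm.antidiagonal 3).over K) u).map_adj_iff.2 hadj, κ, hκ, ?_, ?_, ?_⟩
      · rw [latticeGraphIso_apply_val, hwκ, hmul]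
      · rw [hpair κ y₁]; exact ht₁
      · rw [hpair κ y₂]; exact ht₂
  rw [himage, Set.ncard_image_of_injective _ (latticeGraphIso σ ϖ ((StdForm.antidiagonal 3).over K) u).injective]

end Lattice


/-! ## §3 The three counts at a vertex `u·L₀`: `1 + χ`, `2` (hyperbolic), `1` (END) -/

section Heads

variable {K : Type*} [Field K] [Valued K ℤᵐ⁰] {σ : K →+* K} {ϖ : K}

/-- **THE REGION-DIRECTION CENSUS at `v = u·L₀` when the second test is residually vacuous** (`y₂ ∈ ϖ𝒪³`, i.e. ROOT ∕ INTERIOR vertices): the children `(uκ)·N₁` with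
`|⟨(uκ)e₀, u y₁⟩| < 1 ∧ |⟨(uκ)e₀, u y₂⟩| < 1` number `1 + χ(Q(ȳ₁))` (in `ℤ`) when `ȳ₁` is anisotropic — `Q(ȳ₁) = ᵗȳ₁J̄₀ȳ₁`. [cite: Kottwitz1986, §3] [cite: BruhatTits1972, §10]
[cite: IrelandRosen1990, Ch. 8 §1] -/
theorem ncard_children_linTest_eq_one_add_quadraticChar (hσ : ∀ x, σ (σ x) = x) (hvσ : ∀ a, Valued.v (σ a) = Valued.v a) (hσϖ : σ ϖ = -ϖ)
    (hϖ : Valued.v ϖ = WithZero.exp (-1 : ℤ)) (hres : ∀ x : K, Valued.v x ≤ 1 → Valued.v (σ x - x) < 1) (h2 : Valued.v (2 : K) = 1) [Fintype 𝓀[K]] [DecidableEq 𝓀[K]]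
    (u : unitaryGroupOfForm σ ((StdForm.antidiagonal 3).over K)) (y₁ y₂ : Fin 3 → 𝒪[K])
    (hy₁ : (fun i => IsLocalRing.residue 𝒪[K] (y₁ i)) ⬝ᵥ (((StdForm.antidiagonal 3).over 𝓀[K]) *ᵥ (fun i => IsLocalRing.residue 𝒪[K] (y₁ i))) ≠ 0)
    (hy₂ : (fun i => IsLocalRing.residue 𝒪[K] (y₂ i)) = 0) :
    (({c | c ∈ (latticeGraph σ ϖ ((StdForm.antidiagonal 3).over K)).neighborSet
          (latticeGraphIso σ ϖ ((StdForm.antidiagonal 3).over K) u ⟨stdLattice K 3, 0, isSelfDualLattice_stdLattice_three_of_v hϖ⟩) ∧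
        ∃ κ : unitaryGroupOfForm σ ((StdForm.antidiagonal 3).over K), κ ∈ unitaryInt σ ((StdForm.antidiagonal 3).over K) ∧
          c.1 = mapGL (((u * κ : unitaryGroupOfForm σ ((StdForm.antidiagonal 3).over K)) : GL (Fin 3) K)) (latt (Matrix.diagonal ![(1 : K), 1, ϖ])) ∧
          Valued.v (pairing σ ((StdForm.antidiagonal 3).over K) ((((u * κ : unitaryGroupOfForm σ ((StdForm.antidiagonal 3).over K)) : GL (Fin 3) K) : Matrix (Fin 3) (Fin 3) K) *ᵥ (Pi.single 0 1)) (((u : GL (Fin 3) K) : Matrix (Fin 3) (Fin 3) K) *ᵥ (fun i => (y₁ i : K)))) < 1 ∧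
          Valued.v (pairing σ ((StdForm.antidiagonal 3).over K) ((((u * κ : unitaryGroupOfForm σ ((StdForm.antidiagonal 3).over K)) : GL (Fin 3) K) : Matrix (Fin 3) (Fin 3) K) *ᵥ (Pi.single 0 1)) (((u : GL (Fin 3) K) : Matrix (Fin 3) (Fin 3) K) *ᵥ (fun i => (y₂ i : K)))) < 1}.ncard : ℕ) : ℤ) =
      1 + quadraticChar 𝓀[K] ((fun i => IsLocalRing.residue 𝒪[K] (y₁ i)) ⬝ᵥ (((StdForm.antidiagonal 3).over 𝓀[K]) *ᵥ (fun i => IsLocalRing.residue 𝒪[K] (y₁ i)))) := by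
  rw [ncard_neighborSet_linTest_eq_natCard hσ hvσ hσϖ hϖ hres h2 u y₁ y₂, hy₂, ← natCard_params_orthogonal_eq (ringChar_residueField_ne_two h2) hy₁]
  congr 1
  exact Nat.card_congr (Equiv.subtypeEquivRight fun p => by rw [Matrix.mulVec_zero, dotProduct_zero]; exact and_iff_left rfl)

/-- **HYPERBOLIC ⇒ EXACTLY TWO REGION DIRECTIONS** (ROOT with a residually isotropic root plane, or an INTERIOR vertex with its inward line as witness): if some PRIMITIVE
`z ∈ 𝒪³` is residually isotropic and residually orthogonal to `y₁` (`|B₀(z, z)| < 1`, `|B₀(z, y₁)| < 1`), `y₁` is residually anisotropic and `y₂ ∈ ϖ𝒪³`, then EXACTLY `2`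
children of `u·L₀` pass the two linear tests. [cite: Kottwitz1986, §3] [cite: BruhatTits1972, §10] [cite: Serre1980Trees, II.1.1] -/
theorem ncard_children_linTest_eq_two (hσ : ∀ x, σ (σ x) = x) (hvσ : ∀ a, Valued.v (σ a) = Valued.v a) (hσϖ : σ ϖ = -ϖ)
    (hϖ : Valued.v ϖ = WithZero.exp (-1 : ℤ)) (hres : ∀ x : K, Valued.v x ≤ 1 → Valued.v (σ x - x) < 1) (h2 : Valued.v (2 : K) = 1) [Finite 𝓀[K]]
    (u : unitaryGroupOfForm σ ((StdForm.antidiagonal 3).over K)) (y₁ y₂ : Fin 3 → 𝒪[K])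
    (hy₁ : ¬ Valued.v (B₀ σ 3 (fun i => (y₁ i : K)) (fun i => (y₁ i : K))) < 1)
    (hy₂ : (fun i => IsLocalRing.residue 𝒪[K] (y₂ i)) = 0)
    (z : Fin 3 → 𝒪[K]) (hzu : ∃ j, Valued.v ((z j : 𝒪[K]) : K) = 1) (hziso : Valued.v (B₀ σ 3 (fun i => (z i : K)) (fun i => (z i : K))) < 1)
    (hzy : Valued.v (B₀ σ 3 (fun i => (z i : K)) (fun i => (y₁ i : K))) < 1) :
    {c | c ∈ (latticeGraph σ ϖ ((StdForm.antidiagonal 3).over K)).neighborSet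
          (latticeGraphIso σ ϖ ((StdForm.antidiagonal 3).over K) u ⟨stdLattice K 3, 0, isSelfDualLattice_stdLattice_three_of_v hϖ⟩) ∧
        ∃ κ : unitaryGroupOfForm σ ((StdForm.antidiagonal 3).over K), κ ∈ unitaryInt σ ((StdForm.antidiagonal 3).over K) ∧
          c.1 = mapGL (((u * κ : unitaryGroupOfForm σ ((StdForm.antidiagonal 3).over K)) : GL (Fin 3) K)) (latt (Matrix.diagonal ![(1 : K), 1, ϖ])) ∧
          Valued.v (pairing σ ((StdForm.antidiagonal 3).over K) ((((u * κ : unitaryGroupOfForm σ ((StdForm.antidiagonal 3).over K)) : GL (Fin 3) K) : Matrix (Fin 3) (Fin 3) K) *ᵥ (Pi.single 0 1)) (((u : GL (Fin 3) K) : Matrix (Fin 3) (Fin 3) K) *ᵥ (fun i => (y₁ i : K)))) < 1 ∧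
          Valued.v (pairing σ ((StdForm.antidiagonal 3).over K) ((((u * κ : unitaryGroupOfForm σ ((StdForm.antidiagonal 3).over K)) : GL (Fin 3) K) : Matrix (Fin 3) (Fin 3) K) *ᵥ (Pi.single 0 1)) (((u : GL (Fin 3) K) : Matrix (Fin 3) (Fin 3) K) *ᵥ (fun i => (y₂ i : K)))) < 1}.ncard = 2 := by
  classical
  haveI : Fintype 𝓀[K] := Fintype.ofFinite _
  have hk := ringChar_residueField_ne_two h2
  have hy₁' : (fun i => IsLocalRing.residue 𝒪[K] (y₁ i)) ⬝ᵥ (((StdForm.antidiagonal 3).over 𝓀[K]) *ᵥ (fun i => IsLocalRing.residue 𝒪[K] (y₁ i))) ≠ 0 :=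
    fun h => hy₁ ((v_B₀_self_lt_one_iff_residue hvσ hres y₁).2 h)
  rw [ncard_neighborSet_linTest_eq_natCard hσ hvσ hσϖ hϖ hres h2 u y₁ y₂, hy₂]
  rw [Nat.card_congr (Equiv.subtypeEquivRight (p := fun p : Option {p : 𝓀[K] × 𝓀[K] // p.2 + (RingHom.id 𝓀[K]) p.2 + p.1 * (RingHom.id 𝓀[K]) p.1 = 0} =>
      (p.elim (Pi.single 2 1) fun q => ![(1 : 𝓀[K]), q.1.1, q.1.2]) ⬝ᵥ (((StdForm.antidiagonal 3).over 𝓀[K]) *ᵥ (fun i => IsLocalRing.residue 𝒪[K] (y₁ i))) = 0 ∧ (p.elim (Pi.single 2 1) fun q => ![(1 : 𝓀[K]), q.1.1, q.1.2]) ⬝ᵥ (((StdForm.antidiagonal 3).over 𝓀[K]) *ᵥ (0 : Fin 3 → 𝓀[K])) = 0)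
      (q := fun p : Option {p : 𝓀[K] × 𝓀[K] // p.2 + (RingHom.id 𝓀[K]) p.2 + p.1 * (RingHom.id 𝓀[K]) p.1 = 0} => (p.elim (Pi.single 2 1) fun q => ![(1 : 𝓀[K]), q.1.1, q.1.2]) ⬝ᵥ (((StdForm.antidiagonal 3).over 𝓀[K]) *ᵥ (fun i => IsLocalRing.residue 𝒪[K] (y₁ i))) = 0)
      fun p => by rw [Matrix.mulVec_zero, dotProduct_zero]; exact and_iff_left rfl)]
  exact natCard_params_orthogonal_eq_two hk hy₁' ((exists_v_eq_one_iff_residue_ne_zero z).1 hzu)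
    ((v_B₀_self_lt_one_iff_residue hvσ hres z).1 hziso) ((v_B₀_lt_one_iff_residue hvσ hres z y₁).1 hzy)

/-- **END ⇒ EXACTLY ONE REGION DIRECTION**: if `y₂ ∈ 𝒪³` is PRIMITIVE, residually isotropic and residually orthogonal to `y₁` (`|B₀(y₂, y₂)| < 1`, `|B₀(y₂, y₁)| < 1`), then
EXACTLY `1` child of `u·L₀` passes the two linear tests — the line of `ȳ₂` itself (distinct isotropic lines are never orthogonal). [cite: Kottwitz1986, §3] [cite: BruhatTits1972, §10]
[cite: Serre1980Trees, II.1.1] -/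
theorem ncard_children_linTest_eq_one (hσ : ∀ x, σ (σ x) = x) (hvσ : ∀ a, Valued.v (σ a) = Valued.v a) (hσϖ : σ ϖ = -ϖ)
    (hϖ : Valued.v ϖ = WithZero.exp (-1 : ℤ)) (hres : ∀ x : K, Valued.v x ≤ 1 → Valued.v (σ x - x) < 1) (h2 : Valued.v (2 : K) = 1) [Finite 𝓀[K]]
    (u : unitaryGroupOfForm σ ((StdForm.antidiagonal 3).over K)) (y₁ y₂ : Fin 3 → 𝒪[K])
    (hy₂u : ∃ j, Valued.v ((y₂ j : 𝒪[K]) : K) = 1) (hy₂iso : Valued.v (B₀ σ 3 (fun i => (y₂ i : K)) (fun i => (y₂ i : K))) < 1)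
    (hy₂₁ : Valued.v (B₀ σ 3 (fun i => (y₂ i : K)) (fun i => (y₁ i : K))) < 1) :
    {c | c ∈ (latticeGraph σ ϖ ((StdForm.antidiagonal 3).over K)).neighborSet
          (latticeGraphIso σ ϖ ((StdForm.antidiagonal 3).over K) u ⟨stdLattice K 3, 0, isSelfDualLattice_stdLattice_three_of_v hϖ⟩) ∧
        ∃ κ : unitaryGroupOfForm σ ((StdForm.antidiagonal 3).over K), κ ∈ unitaryInt σ ((StdForm.antidiagonal 3).over K) ∧
          c.1 = mapGL (((u * κ : unitaryGroupOfForm σ ((StdForm.antidiagonal 3).over K)) : GL (Fin 3) K)) (latt (Matrix.diagonal ![(1 : K), 1, ϖ])) ∧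
          Valued.v (pairing σ ((StdForm.antidiagonal 3).over K) ((((u * κ : unitaryGroupOfForm σ ((StdForm.antidiagonal 3).over K)) : GL (Fin 3) K) : Matrix (Fin 3) (Fin 3) K) *ᵥ (Pi.single 0 1)) (((u : GL (Fin 3) K) : Matrix (Fin 3) (Fin 3) K) *ᵥ (fun i => (y₁ i : K)))) < 1 ∧
          Valued.v (pairing σ ((StdForm.antidiagonal 3).over K) ((((u * κ : unitaryGroupOfForm σ ((StdForm.antidiagonal 3).over K)) : GL (Fin 3) K) : Matrix (Fin 3) (Fin 3) K) *ᵥ (Pi.single 0 1)) (((u : GL (Fin 3) K) : Matrix (Fin 3) (Fin 3) K) *ᵥ (fun i => (y₂ i : K)))) < 1}.ncard = 1 := by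
  classical
  haveI : Fintype 𝓀[K] := Fintype.ofFinite _
  rw [ncard_neighborSet_linTest_eq_natCard hσ hvσ hσϖ hϖ hres h2 u y₁ y₂]
  exact natCard_params_orthogonal_orthogonal_eq_one (ringChar_residueField_ne_two h2) _ ((exists_v_eq_one_iff_residue_ne_zero y₂).1 hy₂u)
    ((v_B₀_self_lt_one_iff_residue hvσ hres y₂).1 hy₂iso) ((v_B₀_lt_one_iff_residue hvσ hres y₂ y₁).1 hy₂₁)

end Heads

/-! ## §4 (ED. 2) The same counts in the REG-DIRECTION currency of ★ `UnitaryLatticeTreeIsocelesRegionBranchingRamified` (F0P3-p03 (g15)) — the set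
`{c | Adj v c ∧ ∃ κ ∈ K₀, c = (uκ)·N₁ ∧ RegDir_u κ}` of ★ `ncard_outward_regDir_add_one_eq_ncard_regDir` CHARACTER FOR CHARACTER (ref5 R-379's three rewrites done here) -/

section RegDir

variable {K : Type*} [Field K] [Valued K ℤᵐ⁰] {σ : K →+* K} {ϖ : K}

/-- **THE BRIDGE IN REG-DIRECTION CURRENCY.**  At `v = u·L₀`, with the two test vectors `A e_{i₀} = u·y₁` and `ϖ^{s′}·A e_k = u·y₂` (`y₁, y₂ ∈ 𝒪³` the `u`-frame coordinates
supplied by the consumer), the children `c = (uκ)·N₁` adjacent to `v` with `RegDir_u κ` (the two ★ LINE-TEST pairings `< 1`) are counted by the normalised isotropic parameters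
`⊥ ȳ₁, ȳ₂` — §2's bridge after `Adj v c ↔ c ∈ star(u·L₀)`, `c = (uκ)·N₁ ↔ c.1 = (uκ)·latt N₁`, and the two test-vector identities. [cite: BruhatTits1972, §10] [cite: Kottwitz1986, §3] -/
theorem ncard_adj_regDir_eq_natCard (hσ : ∀ x, σ (σ x) = x) (hvσ : ∀ a, Valued.v (σ a) = Valued.v a) (hσϖ : σ ϖ = -ϖ)
    (hϖ : Valued.v ϖ = WithZero.exp (-1 : ℤ)) (hres : ∀ x : K, Valued.v x ≤ 1 → Valued.v (σ x - x) < 1) (h2 : Valued.v (2 : K) = 1) [Finite 𝓀[K]]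
    (A : GL (Fin 3) K) (i₀ : Fin 3) (s' : ℕ) (k : Fin 3)
    (u : unitaryGroupOfForm σ ((StdForm.antidiagonal 3).over K)) {v : {M : Submodule 𝒪[K] (Fin 3 → K) // IsVertex σ ϖ ((StdForm.antidiagonal 3).over K) M}}
    (hvu : v = latticeGraphIso σ ϖ ((StdForm.antidiagonal 3).over K) u ⟨stdLattice K 3, 0, isSelfDualLattice_stdLattice_three_of_v hϖ⟩)
    (y₁ y₂ : Fin 3 → 𝒪[K]) (hy₁ : (((u : GL (Fin 3) K) : Matrix (Fin 3) (Fin 3) K) *ᵥ (fun i => (y₁ i : K))) = (A : Matrix (Fin 3) (Fin 3) K) *ᵥ Pi.single i₀ 1)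
    (hy₂ : (((u : GL (Fin 3) K) : Matrix (Fin 3) (Fin 3) K) *ᵥ (fun i => (y₂ i : K))) = ϖ ^ s' • ((A : Matrix (Fin 3) (Fin 3) K) *ᵥ Pi.single k 1)) :
    {c : {M : Submodule 𝒪[K] (Fin 3 → K) // IsVertex σ ϖ ((StdForm.antidiagonal 3).over K) M} | (latticeGraph σ ϖ ((StdForm.antidiagonal 3).over K)).Adj v c ∧ ∃ κ : unitaryGroupOfForm σ ((StdForm.antidiagonal 3).over K), κ ∈ unitaryInt σ ((StdForm.antidiagonal 3).over K) ∧
        c = latticeGraphIso σ ϖ ((StdForm.antidiagonal 3).over K) (u * κ) ⟨latt (Matrix.diagonal ![(1 : K), 1, ϖ]), 2, isVertexLattice_two_N₁_of_neg hσϖ hϖ⟩ ∧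
        (Valued.v (pairing σ ((StdForm.antidiagonal 3).over K) ((((u * κ : unitaryGroupOfForm σ ((StdForm.antidiagonal 3).over K)) : GL (Fin 3) K) : Matrix (Fin 3) (Fin 3) K) *ᵥ Pi.single 0 1)
            ((A : Matrix (Fin 3) (Fin 3) K) *ᵥ Pi.single i₀ 1)) < 1 ∧
          Valued.v (pairing σ ((StdForm.antidiagonal 3).over K) ((((u * κ : unitaryGroupOfForm σ ((StdForm.antidiagonal 3).over K)) : GL (Fin 3) K) : Matrix (Fin 3) (Fin 3) K) *ᵥ Pi.single 0 1)
            (ϖ ^ s' • ((A : Matrix (Fin 3) (Fin 3) K) *ᵥ Pi.single k 1))) < 1)}.ncard =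
      Nat.card {p : Option {p : 𝓀[K] × 𝓀[K] // p.2 + (RingHom.id 𝓀[K]) p.2 + p.1 * (RingHom.id 𝓀[K]) p.1 = 0} //
        (p.elim (Pi.single 2 1) fun q => ![(1 : 𝓀[K]), q.1.1, q.1.2]) ⬝ᵥ (((StdForm.antidiagonal 3).over 𝓀[K]) *ᵥ (fun i => IsLocalRing.residue 𝒪[K] (y₁ i))) = 0 ∧
        (p.elim (Pi.single 2 1) fun q => ![(1 : 𝓀[K]), q.1.1, q.1.2]) ⬝ᵥ (((StdForm.antidiagonal 3).over 𝓀[K]) *ᵥ (fun i => IsLocalRing.residue 𝒪[K] (y₂ i))) = 0} := by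
  rw [← ncard_neighborSet_linTest_eq_natCard hσ hvσ hσϖ hϖ hres h2 u y₁ y₂, hy₁, hy₂]
  congr 1
  ext c
  simp only [Set.mem_setOf_eq, SimpleGraph.mem_neighborSet, hvu]
  refine and_congr_right fun _ => exists_congr fun κ => and_congr_right fun _ => ?_
  rw [Subtype.ext_iff, latticeGraphIso_apply_val]

/-- **ROOT ∕ INTERIOR REGION VERTEX: `1 + χ(Q(ȳ₁))` region directions** (REG currency; `y₂ ∈ ϖ𝒪³`, `ȳ₁` anisotropic; in `ℤ`). [cite: Kottwitz1986, §3] [cite: BruhatTits1972, §10]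
[cite: IrelandRosen1990, Ch. 8 §1] -/
theorem ncard_adj_regDir_eq_one_add_quadraticChar (hσ : ∀ x, σ (σ x) = x) (hvσ : ∀ a, Valued.v (σ a) = Valued.v a) (hσϖ : σ ϖ = -ϖ)
    (hϖ : Valued.v ϖ = WithZero.exp (-1 : ℤ)) (hres : ∀ x : K, Valued.v x ≤ 1 → Valued.v (σ x - x) < 1) (h2 : Valued.v (2 : K) = 1) [Fintype 𝓀[K]] [DecidableEq 𝓀[K]]
    (A : GL (Fin 3) K) (i₀ : Fin 3) (s' : ℕ) (k : Fin 3)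
    (u : unitaryGroupOfForm σ ((StdForm.antidiagonal 3).over K)) {v : {M : Submodule 𝒪[K] (Fin 3 → K) // IsVertex σ ϖ ((StdForm.antidiagonal 3).over K) M}}
    (hvu : v = latticeGraphIso σ ϖ ((StdForm.antidiagonal 3).over K) u ⟨stdLattice K 3, 0, isSelfDualLattice_stdLattice_three_of_v hϖ⟩)
    (y₁ y₂ : Fin 3 → 𝒪[K]) (hy₁ : (((u : GL (Fin 3) K) : Matrix (Fin 3) (Fin 3) K) *ᵥ (fun i => (y₁ i : K))) = (A : Matrix (Fin 3) (Fin 3) K) *ᵥ Pi.single i₀ 1)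
    (hy₂ : (((u : GL (Fin 3) K) : Matrix (Fin 3) (Fin 3) K) *ᵥ (fun i => (y₂ i : K))) = ϖ ^ s' • ((A : Matrix (Fin 3) (Fin 3) K) *ᵥ Pi.single k 1))
    (hy₁a : (fun i => IsLocalRing.residue 𝒪[K] (y₁ i)) ⬝ᵥ (((StdForm.antidiagonal 3).over 𝓀[K]) *ᵥ (fun i => IsLocalRing.residue 𝒪[K] (y₁ i))) ≠ 0)
    (hy₂0 : (fun i => IsLocalRing.residue 𝒪[K] (y₂ i)) = 0) :
    (({c : {M : Submodule 𝒪[K] (Fin 3 → K) // IsVertex σ ϖ ((StdForm.antidiagonal 3).over K) M} | (latticeGraph σ ϖ ((StdForm.antidiagonal 3).over K)).Adj v c ∧ ∃ κ : unitaryGroupOfForm σ ((StdForm.antidiagonal 3).over K), κ ∈ unitaryInt σ ((StdForm.antidiagonal 3).over K) ∧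
        c = latticeGraphIso σ ϖ ((StdForm.antidiagonal 3).over K) (u * κ) ⟨latt (Matrix.diagonal ![(1 : K), 1, ϖ]), 2, isVertexLattice_two_N₁_of_neg hσϖ hϖ⟩ ∧
        (Valued.v (pairing σ ((StdForm.antidiagonal 3).over K) ((((u * κ : unitaryGroupOfForm σ ((StdForm.antidiagonal 3).over K)) : GL (Fin 3) K) : Matrix (Fin 3) (Fin 3) K) *ᵥ Pi.single 0 1)
            ((A : Matrix (Fin 3) (Fin 3) K) *ᵥ Pi.single i₀ 1)) < 1 ∧
          Valued.v (pairing σ ((StdForm.antidiagonal 3).over K) ((((u * κ : unitaryGroupOfForm σ ((StdForm.antidiagonal 3).over K)) : GL (Fin 3) K) : Matrix (Fin 3) (Fin 3) K) *ᵥ Pi.single 0 1)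
            (ϖ ^ s' • ((A : Matrix (Fin 3) (Fin 3) K) *ᵥ Pi.single k 1))) < 1)}.ncard : ℕ) : ℤ) =
      1 + quadraticChar 𝓀[K] ((fun i => IsLocalRing.residue 𝒪[K] (y₁ i)) ⬝ᵥ (((StdForm.antidiagonal 3).over 𝓀[K]) *ᵥ (fun i => IsLocalRing.residue 𝒪[K] (y₁ i)))) := by
  rw [ncard_adj_regDir_eq_natCard hσ hvσ hσϖ hϖ hres h2 A i₀ s' k u hvu y₁ y₂ hy₁ hy₂, hy₂0, ← natCard_params_orthogonal_eq (ringChar_residueField_ne_two h2) hy₁a]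
  congr 1
  exact Nat.card_congr (Equiv.subtypeEquivRight fun p => by rw [Matrix.mulVec_zero, dotProduct_zero]; exact and_iff_left rfl)

/-- **HYPERBOLIC ⇒ EXACTLY TWO REGION DIRECTIONS** (REG currency): `y₁` residually anisotropic, `y₂ ∈ ϖ𝒪³`, and a primitive `z ∈ 𝒪³` with `|B₀(z, z)| < 1`, `|B₀(z, y₁)| < 1`
(root: `z = A(e_j + t e_k)` from the S45 token `hhyp`; interior: the inward line). [cite: Kottwitz1986, §3] [cite: BruhatTits1972, §10] [cite: Serre1980Trees, II.1.1] -/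
theorem ncard_adj_regDir_eq_two (hσ : ∀ x, σ (σ x) = x) (hvσ : ∀ a, Valued.v (σ a) = Valued.v a) (hσϖ : σ ϖ = -ϖ)
    (hϖ : Valued.v ϖ = WithZero.exp (-1 : ℤ)) (hres : ∀ x : K, Valued.v x ≤ 1 → Valued.v (σ x - x) < 1) (h2 : Valued.v (2 : K) = 1) [Finite 𝓀[K]]
    (A : GL (Fin 3) K) (i₀ : Fin 3) (s' : ℕ) (k : Fin 3)
    (u : unitaryGroupOfForm σ ((StdForm.antidiagonal 3).over K)) {v : {M : Submodule 𝒪[K] (Fin 3 → K) // IsVertex σ ϖ ((StdForm.antidiagonal 3).over K) M}}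
    (hvu : v = latticeGraphIso σ ϖ ((StdForm.antidiagonal 3).over K) u ⟨stdLattice K 3, 0, isSelfDualLattice_stdLattice_three_of_v hϖ⟩)
    (y₁ y₂ : Fin 3 → 𝒪[K]) (hy₁ : (((u : GL (Fin 3) K) : Matrix (Fin 3) (Fin 3) K) *ᵥ (fun i => (y₁ i : K))) = (A : Matrix (Fin 3) (Fin 3) K) *ᵥ Pi.single i₀ 1)
    (hy₂ : (((u : GL (Fin 3) K) : Matrix (Fin 3) (Fin 3) K) *ᵥ (fun i => (y₂ i : K))) = ϖ ^ s' • ((A : Matrix (Fin 3) (Fin 3) K) *ᵥ Pi.single k 1))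
    (hy₁a : ¬ Valued.v (B₀ σ 3 (fun i => (y₁ i : K)) (fun i => (y₁ i : K))) < 1)
    (hy₂0 : (fun i => IsLocalRing.residue 𝒪[K] (y₂ i)) = 0)
    (z : Fin 3 → 𝒪[K]) (hzu : ∃ j, Valued.v ((z j : 𝒪[K]) : K) = 1) (hziso : Valued.v (B₀ σ 3 (fun i => (z i : K)) (fun i => (z i : K))) < 1)
    (hzy : Valued.v (B₀ σ 3 (fun i => (z i : K)) (fun i => (y₁ i : K))) < 1) :
    {c : {M : Submodule 𝒪[K] (Fin 3 → K) // IsVertex σ ϖ ((StdForm.antidiagonal 3).over K) M} | (latticeGraph σ ϖ ((StdForm.antidiagonal 3).over K)).Adj v c ∧ ∃ κ : unitaryGroupOfForm σ ((StdForm.antidiagonal 3).over K), κ ∈ unitaryInt σ ((StdForm.antidiagonal 3).over K) ∧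
        c = latticeGraphIso σ ϖ ((StdForm.antidiagonal 3).over K) (u * κ) ⟨latt (Matrix.diagonal ![(1 : K), 1, ϖ]), 2, isVertexLattice_two_N₁_of_neg hσϖ hϖ⟩ ∧
        (Valued.v (pairing σ ((StdForm.antidiagonal 3).over K) ((((u * κ : unitaryGroupOfForm σ ((StdForm.antidiagonal 3).over K)) : GL (Fin 3) K) : Matrix (Fin 3) (Fin 3) K) *ᵥ Pi.single 0 1)
            ((A : Matrix (Fin 3) (Fin 3) K) *ᵥ Pi.single i₀ 1)) < 1 ∧
          Valued.v (pairing σ ((StdForm.antidiagonal 3).over K) ((((u * κ : unitaryGroupOfForm σ ((StdForm.antidiagonal 3).over K)) : GL (Fin 3) K) : Matrix (Fin 3) (Fin 3) K) *ᵥ Pi.single 0 1)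
            (ϖ ^ s' • ((A : Matrix (Fin 3) (Fin 3) K) *ᵥ Pi.single k 1))) < 1)}.ncard = 2 := by
  classical
  haveI : Fintype 𝓀[K] := Fintype.ofFinite _
  have hk := ringChar_residueField_ne_two h2
  have hy₁' : (fun i => IsLocalRing.residue 𝒪[K] (y₁ i)) ⬝ᵥ (((StdForm.antidiagonal 3).over 𝓀[K]) *ᵥ (fun i => IsLocalRing.residue 𝒪[K] (y₁ i))) ≠ 0 :=
    fun h => hy₁a ((v_B₀_self_lt_one_iff_residue hvσ hres y₁).2 h)
  rw [ncard_adj_regDir_eq_natCard hσ hvσ hσϖ hϖ hres h2 A i₀ s' k u hvu y₁ y₂ hy₁ hy₂, hy₂0]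
  rw [Nat.card_congr (Equiv.subtypeEquivRight (p := fun p : Option {p : 𝓀[K] × 𝓀[K] // p.2 + (RingHom.id 𝓀[K]) p.2 + p.1 * (RingHom.id 𝓀[K]) p.1 = 0} =>
      (p.elim (Pi.single 2 1) fun q => ![(1 : 𝓀[K]), q.1.1, q.1.2]) ⬝ᵥ (((StdForm.antidiagonal 3).over 𝓀[K]) *ᵥ (fun i => IsLocalRing.residue 𝒪[K] (y₁ i))) = 0 ∧ (p.elim (Pi.single 2 1) fun q => ![(1 : 𝓀[K]), q.1.1, q.1.2]) ⬝ᵥ (((StdForm.antidiagonal 3).over 𝓀[K]) *ᵥ (0 : Fin 3 → 𝓀[K])) = 0)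
      (q := fun p : Option {p : 𝓀[K] × 𝓀[K] // p.2 + (RingHom.id 𝓀[K]) p.2 + p.1 * (RingHom.id 𝓀[K]) p.1 = 0} => (p.elim (Pi.single 2 1) fun q => ![(1 : 𝓀[K]), q.1.1, q.1.2]) ⬝ᵥ (((StdForm.antidiagonal 3).over 𝓀[K]) *ᵥ (fun i => IsLocalRing.residue 𝒪[K] (y₁ i))) = 0)
      fun p => by rw [Matrix.mulVec_zero, dotProduct_zero]; exact and_iff_left rfl)]
  exact natCard_params_orthogonal_eq_two hk hy₁' ((exists_v_eq_one_iff_residue_ne_zero z).1 hzu)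
    ((v_B₀_self_lt_one_iff_residue hvσ hres z).1 hziso) ((v_B₀_lt_one_iff_residue hvσ hres z y₁).1 hzy)

/-- **END ⇒ EXACTLY ONE REGION DIRECTION** (REG currency): `y₂` primitive, `|B₀(y₂, y₂)| < 1`, `|B₀(y₂, y₁)| < 1`. [cite: Kottwitz1986, §3] [cite: BruhatTits1972, §10]
[cite: Serre1980Trees, II.1.1] -/
theorem ncard_adj_regDir_eq_one (hσ : ∀ x, σ (σ x) = x) (hvσ : ∀ a, Valued.v (σ a) = Valued.v a) (hσϖ : σ ϖ = -ϖ)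
    (hϖ : Valued.v ϖ = WithZero.exp (-1 : ℤ)) (hres : ∀ x : K, Valued.v x ≤ 1 → Valued.v (σ x - x) < 1) (h2 : Valued.v (2 : K) = 1) [Finite 𝓀[K]]
    (A : GL (Fin 3) K) (i₀ : Fin 3) (s' : ℕ) (k : Fin 3)
    (u : unitaryGroupOfForm σ ((StdForm.antidiagonal 3).over K)) {v : {M : Submodule 𝒪[K] (Fin 3 → K) // IsVertex σ ϖ ((StdForm.antidiagonal 3).over K) M}}
    (hvu : v = latticeGraphIso σ ϖ ((StdForm.antidiagonal 3).over K) u ⟨stdLattice K 3, 0, isSelfDualLattice_stdLattice_three_of_v hϖ⟩)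
    (y₁ y₂ : Fin 3 → 𝒪[K]) (hy₁ : (((u : GL (Fin 3) K) : Matrix (Fin 3) (Fin 3) K) *ᵥ (fun i => (y₁ i : K))) = (A : Matrix (Fin 3) (Fin 3) K) *ᵥ Pi.single i₀ 1)
    (hy₂ : (((u : GL (Fin 3) K) : Matrix (Fin 3) (Fin 3) K) *ᵥ (fun i => (y₂ i : K))) = ϖ ^ s' • ((A : Matrix (Fin 3) (Fin 3) K) *ᵥ Pi.single k 1))
    (hy₂u : ∃ j, Valued.v ((y₂ j : 𝒪[K]) : K) = 1) (hy₂iso : Valued.v (B₀ σ 3 (fun i => (y₂ i : K)) (fun i => (y₂ i : K))) < 1)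
    (hy₂₁ : Valued.v (B₀ σ 3 (fun i => (y₂ i : K)) (fun i => (y₁ i : K))) < 1) :
    {c : {M : Submodule 𝒪[K] (Fin 3 → K) // IsVertex σ ϖ ((StdForm.antidiagonal 3).over K) M} | (latticeGraph σ ϖ ((StdForm.antidiagonal 3).over K)).Adj v c ∧ ∃ κ : unitaryGroupOfForm σ ((StdForm.antidiagonal 3).over K), κ ∈ unitaryInt σ ((StdForm.antidiagonal 3).over K) ∧
        c = latticeGraphIso σ ϖ ((StdForm.antidiagonal 3).over K) (u * κ) ⟨latt (Matrix.diagonal ![(1 : K), 1, ϖ]), 2, isVertexLattice_two_N₁_of_neg hσϖ hϖ⟩ ∧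
        (Valued.v (pairing σ ((StdForm.antidiagonal 3).over K) ((((u * κ : unitaryGroupOfForm σ ((StdForm.antidiagonal 3).over K)) : GL (Fin 3) K) : Matrix (Fin 3) (Fin 3) K) *ᵥ Pi.single 0 1)
            ((A : Matrix (Fin 3) (Fin 3) K) *ᵥ Pi.single i₀ 1)) < 1 ∧
          Valued.v (pairing σ ((StdForm.antidiagonal 3).over K) ((((u * κ : unitaryGroupOfForm σ ((StdForm.antidiagonal 3).over K)) : GL (Fin 3) K) : Matrix (Fin 3) (Fin 3) K) *ᵥ Pi.single 0 1)
            (ϖ ^ s' • ((A : Matrix (Fin 3) (Fin 3) K) *ᵥ Pi.single k 1))) < 1)}.ncard = 1 := by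
  classical
  haveI : Fintype 𝓀[K] := Fintype.ofFinite _
  rw [ncard_adj_regDir_eq_natCard hσ hvσ hσϖ hϖ hres h2 A i₀ s' k u hvu y₁ y₂ hy₁ hy₂]
  exact natCard_params_orthogonal_orthogonal_eq_one (ringChar_residueField_ne_two h2) _ ((exists_v_eq_one_iff_residue_ne_zero y₂).1 hy₂u)
    ((v_B₀_self_lt_one_iff_residue hvσ hres y₂).1 hy₂iso) ((v_B₀_lt_one_iff_residue hvσ hres y₂ y₁).1 hy₂₁)

end RegDir

end Literature.NumberTheory.Automorphic.UnitaryLatticeTree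

end
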